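import Mathlib
import Summits.MatrixMultiplication.MatrixMultiplication.Theorems.LieRankDesigns.Negative.Basics
import Summits.MatrixMultiplication.MatrixMultiplication.Theorems.SubgroupIdentityDesigns.Negative.DecoratedSylowShapes
import Summits.MatrixMultiplication.MatrixMultiplication.Theorems.SubgroupIdentityDesigns.Negative.NormOneTorus
import Summits.MatrixMultiplication.MatrixMultiplication.Theorems.SubgroupIdentityDesigns.Negative.ScalarLaw

/-!
# FULL split-torus-normaliser image ⇒ every vector has a fixer (`(m,k) = (2,1)`, all odd `p`)

Route `LevelGradedCohnUmans`, crux `SubgroupIdentityDesigns` (stmt-MatrixMultiplication-14079),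
negative side, cell `(m,k) = (2,1)`.  By `WitnessFreeVector` every member of a level-one witness
has a FREE VECTOR (a non-zero vector with trivial stabiliser), and by `ImageCeiling` three members
whose projective images have order `≤ p + 1` never witness the cell for `ε ≤ 0.98` (`p ≥ 61`).
A `p`-free member inside a torus normaliser `N` (Dickson's list) has image of order dividing
`|N/Z| = 2(p ∓ 1)`, so the only way to exceed `p + 1` is the FULL image `H Z ⊇ N`.  This file (split
torus) and `FullImageNonsplit` (non-split torus) prove, by explicit `2 × 2` algebra and one parity
fact in the cyclic group `𝔽_pˣ`, that a full image kills the free vector: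

* `mem_of_pow_natCard_eq_one` — in a finite cyclic group, `x ^ |S| = 1 ⇒ x ∈ S`;
* `units_mem_of_sq_mem` — PARITY: if a subgroup `S ≤ 𝔽_pˣ` (`p` odd) contains a non-square, then
  `μ² ∈ S ⇒ μ ∈ S` (the index of `S` is odd);
* `scalar_sq_mem_of_mul_mem`, `mem_of_mul_scalar_mem_of_sq_one` — for `g` with `g² = ν · 1`,
  `g λ ∈ H` puts `ν λ²` into `S = H ∩ Z`; with parity and `g² = 1` it puts `g` itself into `H`;
* `fixers_of_full_split` — **split torus**: if `H Z` contains every monomial matrix (the image of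
  `H` in `PGL₂(𝔽_p)` contains the full dihedral group `N(T)/Z` of order `2(p-1)`), then every
  non-zero vector is fixed by a non-identity element of `H` (`p` odd): `H` contains the swap `s`,
  every `diag(x, x⁻¹)`, and some `diag(1, y)` with `y ≠ 1` (a non-square scalar in `S` comes from
  `g = [[0, ν], [1, 0]]`, which makes the index of `S` odd).

VALUE = THEOREM (all odd `p`), NOT summit progress; the crux item is untouched and remains open.
Report: `run/shared/lean/b2b/levelgraded-cu/ORACLE-g16.md` §G16-2.
-/

set_option linter.dupNamespace false

noncomputable section

open scoped Classical
open Summit.MatrixMultiplication.MatrixMultiplication.Theorems.LieRankDesigns.Negative (GLm Mat)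

namespace Summit.MatrixMultiplication.MatrixMultiplication.Theorems.SubgroupIdentityDesigns.Negative

section Parity

/-- In a finite cyclic group, `x ^ |S| = 1` forces `x ∈ S` (the solutions of `y ^ |S| = 1` are at
most `|S|` many and contain `S`). -/
theorem mem_of_pow_natCard_eq_one {C : Type*} [CommGroup C] [Finite C] [IsCyclic C]
    (S : Subgroup C) {x : C} (hx : x ^ Nat.card S = 1) : x ∈ S := by
  classical
  letI := Fintype.ofFinite C
  have hs : 0 < Nat.card S := Nat.card_pos
  set F := Finset.univ.filter (fun y : C => y ^ Nat.card S = 1) with hF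
  have hsub : (S : Set C).toFinset ⊆ F := by
    intro y hy
    rw [Set.mem_toFinset] at hy
    rw [hF, Finset.mem_filter]
    refine ⟨Finset.mem_univ _, ?_⟩
    have h1 : ((⟨y, hy⟩ : S) : C) ^ Nat.card S = 1 :=
      orderOf_dvd_iff_pow_eq_one.mp (by rw [Subgroup.orderOf_coe]; exact orderOf_dvd_natCard _)
    exact h1
  have hcardF : F.card ≤ Nat.card S := IsCyclic.card_pow_eq_one_le hs
  have hcardS : ((S : Set C).toFinset).card = Nat.card S := by
    rw [← Nat.card_eq_card_toFinset]; rfl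
  have heq : (S : Set C).toFinset = F :=
    Finset.eq_of_subset_of_card_le hsub (by rw [hcardS]; exact hcardF)
  have hxF : x ∈ F := by
    rw [hF, Finset.mem_filter]; exact ⟨Finset.mem_univ _, hx⟩
  rw [← heq, Set.mem_toFinset] at hxF
  exact hxF

variable {p : ℕ} [hp : Fact p.Prime]

/-- **Parity.**  If a subgroup `S ≤ 𝔽_pˣ` (`p` odd) contains a non-square, its index is odd:
`μ ^ 2 ∈ S ⇒ μ ∈ S`. -/
theorem units_mem_of_sq_mem (hp2 : p ≠ 2) (S : Subgroup (ZMod p)ˣ) {s₀ : (ZMod p)ˣ}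
    (hs₀ : s₀ ∈ S) (hns : ¬ IsSquare s₀) {μ : (ZMod p)ˣ} (hμ : μ ^ 2 ∈ S) : μ ∈ S := by
  classical
  have hodd : Odd p := hp.out.odd_of_ne_two hp2
  obtain ⟨k, hk⟩ := hodd
  set s := Nat.card S with hsdef
  have hN : Fintype.card (ZMod p)ˣ = p - 1 := ZMod.card_units p
  have hsN : s ∣ p - 1 := by
    rw [hsdef, ← hN, ← Nat.card_eq_fintype_card]; exact Subgroup.card_subgroup_dvd_card S
  obtain ⟨t, ht⟩ := hsN
  -- powers
  have hs₀pow : s₀ ^ s = 1 :=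
    orderOf_dvd_iff_pow_eq_one.mp (by
      have := orderOf_dvd_natCard (⟨s₀, hs₀⟩ : S)
      rwa [Subgroup.orderOf_mk] at this)
  have hμ2s : μ ^ (2 * s) = 1 := by
    rw [pow_mul]
    exact orderOf_dvd_iff_pow_eq_one.mp (by
      have := orderOf_dvd_natCard (⟨μ ^ 2, hμ⟩ : S)
      rwa [Subgroup.orderOf_mk] at this)
  have hμN : μ ^ (p - 1) = 1 := by rw [← hN]; exact pow_card_eq_one
  -- t is odd, for otherwise s ∣ (p-1)/2 and s₀ would be a square (Euler)
  have htodd : Odd t := by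
    by_contra hte
    rw [Nat.not_odd_iff_even] at hte
    obtain ⟨u, hu⟩ := hte
    have h1 : p - 1 = 2 * (s * u) := by rw [ht, hu]; ring
    have hdiv : p / 2 = s * u := by omega
    have hsq : s₀ ^ (p / 2) = 1 := by rw [hdiv, pow_mul, hs₀pow, one_pow]
    obtain ⟨y, hy⟩ := (ZMod.euler_criterion_units p s₀).mpr hsq
    exact hns ⟨y, by rw [← hy, sq]⟩
  have hgcd : Nat.gcd (2 * s) (p - 1) = s := by
    rw [ht, mul_comm 2 s, Nat.gcd_mul_left, (Nat.coprime_two_left.mpr htodd).gcd_eq_one,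
      mul_one]
  have hμs : μ ^ s = 1 := by
    have := pow_gcd_eq_one.mpr ⟨hμ2s, hμN⟩
    rwa [hgcd] at this
  exact mem_of_pow_natCard_eq_one S hμs

end Parity

section FullImage

variable {p : ℕ} [hp : Fact p.Prime]

/-! ### Scalars and a few explicit matrices -/

/-- Entries of a scalar matrix. -/
theorem scalarHom_entries (u : (ZMod p)ˣ) :
    ((scalarHom p 2 u : GLm p 2) : Mat p 2) 0 0 = u ∧
    ((scalarHom p 2 u : GLm p 2) : Mat p 2) 0 1 = 0 ∧
    ((scalarHom p 2 u : GLm p 2) : Mat p 2) 1 0 = 0 ∧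
    ((scalarHom p 2 u : GLm p 2) : Mat p 2) 1 1 = u := by
  refine ⟨?_, ?_, ?_, ?_⟩ <;> simp [coe_scalarHom, Matrix.scalar_apply]

/-- A matrix `g` with `g² = ν · 1` (`ν` a unit) and `g · λ ∈ H` puts the scalar `ν λ²` into `H`. -/
theorem scalar_sq_mem_of_mul_mem {H : Subgroup (GLm p 2)} {g : GLm p 2} {ν u : (ZMod p)ˣ}
    (hg2 : g * g = scalarHom p 2 ν) (hgu : g * scalarHom p 2 u ∈ H) :
    scalarHom p 2 (ν * u ^ 2) ∈ H := by
  have h := H.mul_mem hgu hgu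
  have e : g * scalarHom p 2 u * (g * scalarHom p 2 u) = scalarHom p 2 (ν * u ^ 2) := by
    rw [map_mul, map_pow, ← hg2, sq]
    rw [mul_assoc, ← mul_assoc (scalarHom p 2 u) g, scalarHom_comm u g]
    simp only [mul_assoc]
  rwa [e] at h

/-- If `S = H ∩ Z` has odd index (parity hypothesis) and `g λ ∈ H` with `g² = 1`, then `g ∈ H`. -/
theorem mem_of_mul_scalar_mem_of_sq_one {H : Subgroup (GLm p 2)}
    (hpar : ∀ μ : (ZMod p)ˣ, scalarHom p 2 (μ ^ 2) ∈ H → scalarHom p 2 μ ∈ H)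
    {g : GLm p 2} (hg2 : g * g = 1) {u : (ZMod p)ˣ} (hgu : g * scalarHom p 2 u ∈ H) : g ∈ H := by
  have h1 : scalarHom p 2 (1 * u ^ 2) ∈ H :=
    scalar_sq_mem_of_mul_mem (by rw [hg2, map_one]) hgu
  rw [one_mul] at h1
  have hu := hpar u h1
  have := H.mul_mem hgu (H.inv_mem hu)
  rwa [mul_inv_cancel_right] at this

/-- `(2 : 𝔽_p) ≠ 0` for `p` odd, in the form `(1 : 𝔽_p) ≠ -1`. -/
theorem one_ne_neg_one (hp2 : p ≠ 2) : (1 : ZMod p) ≠ -1 := by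
  intro h
  have h2 : ((2 : ℕ) : ZMod p) = 0 := by push_cast; linear_combination h
  rw [CharP.cast_eq_zero_iff (ZMod p) p] at h2
  exact hp2 ((Nat.prime_dvd_prime_iff_eq hp.out Nat.prime_two).mp h2)

/-- A non-square unit exists for `p` odd. -/
theorem exists_nonsquare_unit (hp2 : p ≠ 2) : ∃ ν : (ZMod p)ˣ, ¬ IsSquare ν := by
  have hch : ringChar (ZMod p) ≠ 2 := by rw [ZMod.ringChar_zmod_n]; exact hp2
  obtain ⟨a, ha⟩ := FiniteField.exists_nonsquare hch
  have ha0 : a ≠ 0 := by rintro rfl; exact ha ⟨0, by simp⟩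
  refine ⟨Units.mk0 a ha0, ?_⟩
  rintro ⟨r, hr⟩
  apply ha
  refine ⟨(r : ZMod p), ?_⟩
  have := congrArg (fun x : (ZMod p)ˣ => (x : ZMod p)) hr
  simpa using this

/-! ### Split torus: full monomial image -/

/-- **Full split image ⇒ no free vector.**  `p` odd.  If for every monomial matrix `g` (diagonal or
anti-diagonal, invertible) some scalar multiple `g · λ` lies in `H`, then every non-zero vector is
fixed by some `h ∈ H`, `h ≠ 1`. -/
theorem fixers_of_full_split (hp2 : p ≠ 2) {H : Subgroup (GLm p 2)}
    (hfull : ∀ g : GLm p 2,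
      (((g : Mat p 2) 0 1 = 0 ∧ (g : Mat p 2) 1 0 = 0) ∨
        ((g : Mat p 2) 0 0 = 0 ∧ (g : Mat p 2) 1 1 = 0)) →
      ∃ u : (ZMod p)ˣ, g * scalarHom p 2 u ∈ H) :
    ∀ a : Fin 2 → ZMod p, a ≠ 0 →
      ∃ h ∈ H, h ≠ 1 ∧ ((h : GLm p 2) : Mat p 2).mulVec a = a := by
  obtain ⟨ν, hν⟩ := exists_nonsquare_unit (p := p) hp2
  have hsc := fun u : (ZMod p)ˣ => scalarHom_entries (p := p) u
  -- (1) a non-square scalar in H, via m = [[0, ν], [1, 0]], m² = ν·1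
  obtain ⟨m, m00, m01, m10, m11⟩ := exists_gl2 (p := p) 0 (ν : ZMod p) 1 0
    (by rw [zero_mul, zero_sub, neg_ne_zero, mul_one]; exact ν.ne_zero)
  have hm2 : m * m = scalarHom p 2 ν := by
    obtain ⟨s00, s01, s10, s11⟩ := hsc ν
    apply gl2_ext <;> simp only [gl2_mul_apply, m00, m01, m10, m11, s00, s01, s10, s11] <;> ring
  obtain ⟨u₀, hu₀⟩ := hfull m (Or.inr ⟨m00, m11⟩)
  have hS₀ : scalarHom p 2 (ν * u₀ ^ 2) ∈ H := scalar_sq_mem_of_mul_mem hm2 hu₀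
  have hns : ¬ IsSquare (ν * u₀ ^ 2) := by
    rintro ⟨r, hr⟩
    exact hν ⟨r * u₀⁻¹, by
      have : ν = r * r * (u₀ ^ 2)⁻¹ := by rw [← hr, mul_inv_cancel_right]
      rw [this, sq, mul_inv, mul_mul_mul_comm]⟩
  -- parity for S = H.comap scalarHom
  have hpar : ∀ μ : (ZMod p)ˣ, scalarHom p 2 (μ ^ 2) ∈ H → scalarHom p 2 μ ∈ H := by
    intro μ hμ
    have := units_mem_of_sq_mem hp2 (H.comap (scalarHom p 2)) (s₀ := ν * u₀ ^ 2)
      (by rw [Subgroup.mem_comap]; exact hS₀) hns (μ := μ) (by rw [Subgroup.mem_comap]; exact hμ)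
    rwa [Subgroup.mem_comap] at this
  -- (2) the swap s ∈ H
  obtain ⟨s, s00, s01, s10, s11⟩ := exists_gl2 (p := p) 0 1 1 0 (by norm_num)
  have hs2 : s * s = 1 := by
    obtain ⟨o00, o01, o10, o11⟩ := gl2_one_apply (p := p)
    apply gl2_ext <;> simp only [gl2_mul_apply, s00, s01, s10, s11, o00, o01, o10, o11] <;> ring
  obtain ⟨u₁, hu₁⟩ := hfull s (Or.inr ⟨s00, s11⟩)
  have hsH : s ∈ H := mem_of_mul_scalar_mem_of_sq_one hpar hs2 hu₁
  -- (3) every d_x = diag(x, x⁻¹) ∈ H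
  have hd : ∀ x : (ZMod p)ˣ, ∃ d ∈ H, (d : Mat p 2) 0 0 = x ∧ (d : Mat p 2) 0 1 = 0 ∧
      (d : Mat p 2) 1 0 = 0 ∧ (d : Mat p 2) 1 1 = (x⁻¹ : (ZMod p)ˣ) := by
    intro x
    obtain ⟨d, d00, d01, d10, d11⟩ := exists_gl2 (p := p) (x : ZMod p) 0 0 ((x⁻¹ : (ZMod p)ˣ))
      (by rw [mul_zero, sub_zero, ← Units.val_mul, mul_inv_cancel, Units.val_one]; exact one_ne_zero)
    obtain ⟨d', e00, e01, e10, e11⟩ := exists_gl2 (p := p) ((x⁻¹ : (ZMod p)ˣ)) 0 0 (x : ZMod p)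
      (by rw [mul_zero, sub_zero, ← Units.val_mul, inv_mul_cancel, Units.val_one]; exact one_ne_zero)
    obtain ⟨u, hu⟩ := hfull d (Or.inl ⟨d01, d10⟩)
    -- s (d u) s = d' u
    have hconj : s * (d * scalarHom p 2 u) * s = d' * scalarHom p 2 u := by
      have e1 : s * d * s = d' := by
        apply gl2_ext <;>
          simp only [gl2_mul_apply, s00, s01, s10, s11, d00, d01, d10, d11, e00, e01, e10, e11] <;>
          ring
      rw [← e1, show s * (d * scalarHom p 2 u) * s = s * d * (scalarHom p 2 u * s) by
        simp only [mul_assoc], scalarHom_comm u s, ← mul_assoc]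
    have hd'u : d' * scalarHom p 2 u ∈ H := by
      rw [← hconj]; exact H.mul_mem (H.mul_mem hsH hu) hsH
    -- (d u)(d' u) = u² · 1
    have hdd' : d * d' = 1 := by
      obtain ⟨o00, o01, o10, o11⟩ := gl2_one_apply (p := p)
      apply gl2_ext <;>
        simp only [gl2_mul_apply, d00, d01, d10, d11, e00, e01, e10, e11, o00, o01, o10, o11,
          ← Units.val_mul, mul_inv_cancel, inv_mul_cancel, Units.val_one] <;> ring
    have hprod : d * scalarHom p 2 u * (d' * scalarHom p 2 u) = scalarHom p 2 (u ^ 2) := by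
      rw [map_pow, sq, mul_assoc, ← mul_assoc (scalarHom p 2 u) d', scalarHom_comm u d',
        mul_assoc, ← mul_assoc d d', hdd', one_mul]
    have hu2 : scalarHom p 2 (u ^ 2) ∈ H := by rw [← hprod]; exact H.mul_mem hu hd'u
    have huH := hpar u hu2
    refine ⟨d, ?_, d00, d01, d10, d11⟩
    have := H.mul_mem hu (H.inv_mem huH)
    rwa [mul_inv_cancel_right] at this
  -- (4) e = diag(1, y) ∈ H with y ≠ 1, and its swap conjugate
  obtain ⟨g, g00, g01, g10, g11⟩ := exists_gl2 (p := p) 1 0 0 (ν : ZMod p)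
    (by rw [one_mul, zero_mul, sub_zero]; exact ν.ne_zero)
  obtain ⟨u₂, hu₂⟩ := hfull g (Or.inl ⟨g01, g10⟩)
  obtain ⟨d₂, hd₂H, q00, q01, q10, q11⟩ := hd u₂⁻¹
  have heH : g * scalarHom p 2 u₂ * d₂ ∈ H := H.mul_mem hu₂ hd₂H
  obtain ⟨c00, c01, c10, c11⟩ := hsc u₂
  have hu₂inv : (u₂ : ZMod p) * ((u₂⁻¹ : (ZMod p)ˣ) : ZMod p) = 1 := by
    rw [← Units.val_mul, mul_inv_cancel, Units.val_one]
  have he00 : ((g * scalarHom p 2 u₂ * d₂ : GLm p 2) : Mat p 2) 0 0 = 1 := by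
    simp only [gl2_mul_apply, g00, g01, c00, c01, c10, c11, q00, q10]
    linear_combination hu₂inv
  have he01 : ((g * scalarHom p 2 u₂ * d₂ : GLm p 2) : Mat p 2) 0 1 = 0 := by
    simp only [gl2_mul_apply, g00, g01, c00, c01, c10, c11, q01, q11]; ring
  have he10 : ((g * scalarHom p 2 u₂ * d₂ : GLm p 2) : Mat p 2) 1 0 = 0 := by
    simp only [gl2_mul_apply, g10, g11, c00, c01, c10, c11, q00, q10]; ring
  have he11 : ((g * scalarHom p 2 u₂ * d₂ : GLm p 2) : Mat p 2) 1 1 = ν * (u₂ : ZMod p) ^ 2 := by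
    simp only [gl2_mul_apply, g10, g11, c01, c11, q01, q11, inv_inv]
    ring
  have hy : (ν : ZMod p) * (u₂ : ZMod p) ^ 2 ≠ 1 := by
    intro h
    apply hν
    refine ⟨u₂⁻¹, ?_⟩
    apply Units.ext
    push_cast
    have hu2 : (u₂ : ZMod p) ≠ 0 := u₂.ne_zero
    field_simp
    linear_combination h
  set e := g * scalarHom p 2 u₂ * d₂ with he
  have he'H : s * e * s ∈ H := H.mul_mem (H.mul_mem hsH heH) hsH
  have f00 : ((s * e * s : GLm p 2) : Mat p 2) 0 0 = ν * (u₂ : ZMod p) ^ 2 := by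
    simp only [gl2_mul_apply, s00, s01, s10, he00, he01, he10, he11]; ring
  have f01 : ((s * e * s : GLm p 2) : Mat p 2) 0 1 = 0 := by
    simp only [gl2_mul_apply, s00, s01, s11, he00, he01, he10, he11]; ring
  have f10 : ((s * e * s : GLm p 2) : Mat p 2) 1 0 = 0 := by
    simp only [gl2_mul_apply, s00, s10, s11, he00, he01, he10, he11]; ring
  have f11 : ((s * e * s : GLm p 2) : Mat p 2) 1 1 = 1 := by
    simp only [gl2_mul_apply, s01, s10, s11, he00, he01, he10, he11]; ring
  have o := gl2_one_apply (p := p)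
  -- conclusion
  intro a ha
  by_cases h0 : a 0 = 0
  · -- a = (0, a₁): fixed by s e s = diag(y, 1)
    refine ⟨s * e * s, he'H, ?_, ?_⟩
    · intro h
      have := congrArg (fun x : GLm p 2 => (x : Mat p 2) 0 0) h
      simp only [f00] at this
      exact hy (this.trans o.1)
    · funext i
      fin_cases i
      · show ((s * e * s : GLm p 2) : Mat p 2).mulVec a 0 = a 0
        rw [mulVec_two_apply_zero, f00, f01, h0]; ring
      · show ((s * e * s : GLm p 2) : Mat p 2).mulVec a 1 = a 1
        rw [mulVec_two_apply_one, f10, f11, h0]; ring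
  by_cases h1 : a 1 = 0
  · -- a = (a₀, 0): fixed by e = diag(1, y)
    refine ⟨e, heH, ?_, ?_⟩
    · intro h
      have := congrArg (fun x : GLm p 2 => (x : Mat p 2) 1 1) h
      simp only [he11] at this
      exact hy (this.trans o.2.2.2)
    · funext i
      fin_cases i
      · show ((e : GLm p 2) : Mat p 2).mulVec a 0 = a 0
        rw [mulVec_two_apply_zero, he00, he01, h1]; ring
      · show ((e : GLm p 2) : Mat p 2).mulVec a 1 = a 1
        rw [mulVec_two_apply_one, he10, he11, h1]; ring
  · -- generic a: fixed by s d_x with x = a₁ / a₀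
    set x : (ZMod p)ˣ := Units.mk0 (a 1) h1 * (Units.mk0 (a 0) h0)⁻¹ with hx
    have hxv : ((x : (ZMod p)ˣ) : ZMod p) = a 1 * (a 0)⁻¹ := by
      rw [hx, Units.val_mul, Units.val_inv_eq_inv_val]; rfl
    have hxi : ((x⁻¹ : (ZMod p)ˣ) : ZMod p) = a 0 * (a 1)⁻¹ := by
      rw [Units.val_inv_eq_inv_val, hxv, mul_inv, inv_inv, mul_comm]
    obtain ⟨d, hdH, d00, d01, d10, d11⟩ := hd x
    refine ⟨s * d, H.mul_mem hsH hdH, ?_, ?_⟩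
    · intro h
      have := congrArg (fun y : GLm p 2 => (y : Mat p 2) 0 0) h
      simp only [gl2_mul_apply, s00, s01, d00, d10] at this
      rw [o.1] at this
      exact one_ne_zero (by linear_combination -this)
    · funext i
      fin_cases i
      · show ((s * d : GLm p 2) : Mat p 2).mulVec a 0 = a 0
        rw [mulVec_two_apply_zero, gl2_mul_apply, gl2_mul_apply, s00, s01, d00, d01, d10, d11, hxi]
        linear_combination (a 0) * inv_mul_cancel₀ h1
      · show ((s * d : GLm p 2) : Mat p 2).mulVec a 1 = a 1
        rw [mulVec_two_apply_one, gl2_mul_apply, gl2_mul_apply, s10, s11, d00, d01, d10, d11, hxv]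
        linear_combination (a 1) * inv_mul_cancel₀ h0

end FullImage

end Summit.MatrixMultiplication.MatrixMultiplication.Theorems.SubgroupIdentityDesigns.Negative

end
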